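import Mathlib
import HarnessLib
import Literature.NumberTheory.Transcendental.KZCalculus
import Literature.NumberTheory.Transcendental.KZGroundingRelations
import Literature.NumberTheory.Transcendental.KZLogCalculusProofs
import Literature.NumberTheory.Transcendental.SemialgebraicMapsProofs

/-!
# Separation engine (line `janus-bands`, crux `ArrangementNormalForm`), part 1: induction

Partial fractions in the distinguished base coordinate `y = z (Fin.last b)` of a Janus band
representation over the base `ℝ^{b+1}` with `k` fibres, INSIDE the Kontsevich–Zagier calculus
(every intermediate representation absolutely convergent, `ℚ`-semialgebraic).

* `SeparatePos.shape` — the separation shape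
  `P(x', y)/∏ Lⱼ(x')^{eⱼ} · ∏ⱼ (y − λⱼ(x'))^{−dⱼ} · (fibre block)` with an ARBITRARY polynomial
  numerator `P` in all base coordinates (the engine never touches the numerator);
* `SeparatePos.exists_piece` — one dominated rule-(1b) piece: the parent times the bounded
  semialgebraic factor `(y − λ_{j'})/(λ_j − λ_{j'})` (`SeparatePos.mulRep`, `Integrable.mul_bdd`);
  the resultant `λ_j − λ_{j'}` joins the `x'`-denominators (`SeparatePos.shape_mul_eq`);
* `SeparatePos.sep_induction` — induction on the total letter multiplicity under the RATIO
  condition `|y − λ_{j'}| ≤ C |λ_j − λ_{j'}|` for all ordered pairs of distinct active letters,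
  with an abstract terminal class `T` receiving the single-letter shapes;
* `SeparatePos.GGset b σ k` — literal copy of the skeleton-v3 class `GG b σ k`, and the terminal
  lemma `SeparatePos.of_mem_GGset_of_shape` (`y`-free numerator ⟹ literally in `GG b 1 k`);
  `SeparatePos.GNset b k` — the intermediate class `GG♮` (arbitrary numerator, one `y`-pole);
* `SeparatePos.restr/root/lead` — the dictionary full-base letter `α (y − λ(x'))` ↦ `λ`, `α^n`.

Registered sub-goal of this file: `separatePos_prod_inv_pow_update` (the multiplicity-lowering
identity driving the induction).  Part 2 (`…SeparateDominated`) instantiates the engine on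
literal `J (b+1)`-data.
-/

noncomputable section

open Set MeasureTheory MvPolynomial

namespace Summit.KontsevichZagierPeriods.ArrangementNormalForm.JanusBands

open Literature.NumberTheory.Transcendental

namespace SeparatePos

section Generic

variable {n : ℕ}

/-- The representation `[σ, f · g]` obtained from `r = [σ, f]` by multiplying the integrand by a
`ℚ`-semialgebraic function `g` bounded on `σ`; it converges absolutely by domination. -/
def mulRep (r : KZ.IntegralRep n) (g : (Fin n → ℝ) → ℝ) (hg : IsSemialgebraicFunOn ℚ r.domain g)
    (C : ℝ) (hC : ∀ x ∈ r.domain, |g x| ≤ C) : KZ.IntegralRep n where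
  domain := r.domain
  integrand x := r.integrand x * g x
  isSemialgebraic_domain := r.isSemialgebraic_domain
  isSemialgebraicFunOn_integrand :=
    IsSemialgebraicFunOn.mul_holds r.isSemialgebraicFunOn_integrand hg
  integrableOn :=
    r.integrableOn.mul_bdd
      (KZ.aestronglyMeasurable_of_isSemialgebraicFunOn hg
        (KZ.IntegralRep.measurableSet_domain_holds r))
      ((ae_restrict_iff' (KZ.IntegralRep.measurableSet_domain_holds r)).mpr
        (Filter.Eventually.of_forall fun x hx => by simpa using hC x hx))

end Generic

section Shapes

variable (b k : ℕ)

/-- An affine form in the first `b` base coordinates `x'` of `z ∈ ℝ^{b+1+k}`. -/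
def affB (c : (Fin b → ℚ) × ℚ) (z : Fin (b + 1 + k) → ℝ) : ℝ :=
  ∑ i, (c.1 i : ℝ) * z (Fin.castAdd k (Fin.castSucc i)) + (c.2 : ℝ)

/-- An affine form in all `b + 1` base coordinates of `z ∈ ℝ^{b+1+k}` (literal `J`/`GG` text). -/
def affF (c : (Fin (b + 1) → ℚ) × ℚ) (z : Fin (b + 1 + k) → ℝ) : ℝ :=
  ∑ i, (c.1 i : ℝ) * z (Fin.castAdd k i) + (c.2 : ℝ)

/-- The linear polynomial whose evaluation is `affB`. -/
def affPoly (c : (Fin b → ℚ) × ℚ) : MvPolynomial (Fin (b + 1 + k)) ℚ :=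
  ∑ i, C (c.1 i) * X (Fin.castAdd k (Fin.castSucc i)) + C c.2

/-- The fibre-letter block `∏ᵢ (aᵢ).elim 1 (c ↦ 1/(tᵢ − c(x)))` (literal `J`/`GG` text). -/
def fib (a : Fin k → Option ((Fin (b + 1) → ℚ) × ℚ)) (z : Fin (b + 1 + k) → ℝ) : ℝ :=
  ∏ i, (a i).elim 1 (fun c => 1 / (z (Fin.natAdd (b + 1) i) -
    (∑ i', (c.1 i' : ℝ) * z (Fin.castAdd k i') + (c.2 : ℝ))))

/-- The separation shape `P(x', y)/∏ Lⱼ(x')^{eⱼ} · ∏ⱼ (y − λⱼ(x'))^{−dⱼ} · (fibre letters)`, with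
an arbitrary polynomial numerator `P` in all `b + 1` base coordinates. -/
def shape {m r : ℕ} (p : MvPolynomial (Fin (b + 1)) ℚ) (L : Fin m → (Fin b → ℚ) × ℚ)
    (e : Fin m → ℕ) (lam : Fin r → (Fin b → ℚ) × ℚ) (d : Fin r → ℕ)
    (a : Fin k → Option ((Fin (b + 1) → ℚ) × ℚ)) (z : Fin (b + 1 + k) → ℝ) : ℝ :=
  MvPolynomial.aeval (fun i => z (Fin.castAdd k i)) p /
    (∏ j, (affB b k (L j) z) ^ e j) *
    (∏ j, ((z (Fin.castAdd k (Fin.last b)) - affB b k (lam j) z) ^ d j)⁻¹) * fib b k a z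

/-- The domain shape of `GG b σ k` (literal text): polyhedral base cell times fibres. -/
def gDom (m' : ℕ) (M : Fin m' → (Fin (b + 1) → ℚ) × ℚ)
    (lo hi : Fin k → Fin k ⊕ ((Fin (b + 1) → ℚ) × ℚ)) : Set (Fin (b + 1 + k) → ℝ) :=
  {z | (∀ j, 0 < ∑ i, ((M j).1 i : ℝ) * z (Fin.castAdd k i) + ((M j).2 : ℝ)) ∧ ∀ i, Sum.elim (fun j => z (Fin.natAdd (b + 1) j)) (fun c => ∑ i', (c.1 i' : ℝ) * z (Fin.castAdd k i') + (c.2 : ℝ)) (lo i) < z (Fin.natAdd (b + 1) i) ∧ z (Fin.natAdd (b + 1) i) < Sum.elim (fun j => z (Fin.natAdd (b + 1) j)) (fun c => ∑ i', (c.1 i' : ℝ) * z (Fin.castAdd k i') + (c.2 : ℝ)) (hi i)}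

/-- A full-base affine form with vanishing `y`-coefficient, read as an `x'`-form. -/
def restr (c : (Fin (b + 1) → ℚ) × ℚ) : (Fin b → ℚ) × ℚ :=
  (fun i => c.1 (Fin.castSucc i), c.2)

/-- The letter `λ(x')` of a full-base affine form `α (y − λ(x'))` with `α ≠ 0`. -/
def root (c : (Fin (b + 1) → ℚ) × ℚ) : (Fin b → ℚ) × ℚ :=
  (fun i => -c.1 (Fin.castSucc i) / c.1 (Fin.last b), -c.2 / c.1 (Fin.last b))

/-- The normalising constant `α^n` of a `y`-letter (and `1` for a `y`-free form). -/
def lead (c : (Fin (b + 1) → ℚ) × ℚ) (n : ℕ) : ℚ :=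
  if c.1 (Fin.last b) = 0 then 1 else c.1 (Fin.last b) ^ n

variable {b k}

/-- `affPoly` evaluates to `affB`. -/
theorem aeval_affPoly (c : (Fin b → ℚ) × ℚ) (z : Fin (b + 1 + k) → ℝ) :
    aeval z (affPoly b k c) = affB b k c z := by
  simp [affPoly, affB, map_sum]

/-- `affB` is additive in the coefficient vector. -/
theorem affB_sub (c c' : (Fin b → ℚ) × ℚ) (z : Fin (b + 1 + k) → ℝ) :
    affB b k (c - c') z = affB b k c z - affB b k c' z := by
  simp only [affB, Prod.fst_sub, Prod.snd_sub, Pi.sub_apply, Rat.cast_sub, sub_mul,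
    Finset.sum_sub_distrib]
  ring

end Shapes

section Classes

/-- Literal copy of the skeleton-v3 class `GG b σ k` (separated / rebased Janus band
representations with `k` fibres), so that the engine can be stated without the hypothesis `hGG`. -/
def GGset (b σ k : ℕ) : Set KZ.FormalRep :=
  {w : KZ.FormalRep | ∃ (m m' n₁ n₂ : ℕ) (s : KZ.IntegralRep (b + 1 + k)) (M : Fin m' → (Fin (b + 1) → ℚ) × ℚ) (L : Fin m → (Fin b → ℚ) × ℚ) (e : Fin m → ℕ) (p : MvPolynomial (Fin b) ℚ) (ℓ₁ ℓ₂ : (Fin b → ℚ) × ℚ) (a : Fin k → Option ((Fin (b + 1) → ℚ) × ℚ)) (lo hi : Fin k → Fin k ⊕ ((Fin (b + 1) → ℚ) × ℚ)), (n₁ = 0 ∨ n₂ = 0) ∧ (σ = 2 → (∀ i c, a i = some c → c.1 (Fin.last b) = 0) ∧ (∀ i c, (lo i = Sum.inr c ∨ hi i = Sum.inr c) → (c.1 (Fin.last b) = 0 ∨ c = (Pi.single (Fin.last b) 1, 0)))) ∧ Bornology.IsBounded s.domain ∧ s.domain = {z | (∀ j, 0 < ∑ i, ((M j).1 i : ℝ)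 * z (Fin.castAdd k i) + ((M j).2 : ℝ)) ∧ ∀ i, Sum.elim (fun j => z (Fin.natAdd (b + 1) j)) (fun c => ∑ i', (c.1 i' : ℝ) * z (Fin.castAdd k i') + (c.2 : ℝ)) (lo i) < z (Fin.natAdd (b + 1) i) ∧ z (Fin.natAdd (b + 1) i) < Sum.elim (fun j => z (Fin.natAdd (b + 1) j)) (fun c => ∑ i', (c.1 i' : ℝ) * z (Fin.castAdd k i') + (c.2 : ℝ)) (hi i)} ∧ EqOn s.integrand (fun z => MvPolynomial.aeval (fun i => z (Fin.castAdd k (Fin.castSucc i))) p / (∏ j, (∑ i, ((L j).1 i : ℝ) * z (Fin.castAdd k (Fin.castSucc i)) + ((L j).2 : ℝ)) ^ e j) * ((z (Fin.castAdd k (Fin.last b)) - (∑ i, (ℓ₁.1 i : ℝ) * z (Fin.castAdd k (Fin.castSucc i)) + (ℓ₁.2 : ℝ))) ^ n₁ / (z (Fin.castAdd k (Fin.last b)) - (∑ i, (ℓ₂.1 i : ℝ) * z (Fin.castAdd k (Fin.castSucc i)) + (ℓ₂.2 : ℝ))) ^ n₂) * ∏ i, (a i).elim 1 (fun c => 1 /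 (z (Fin.natAdd (b + 1) i) - (∑ i', (c.1 i' : ℝ) * z (Fin.castAdd k i') + (c.2 : ℝ))))) s.domain ∧ w = KZ.of s}

/-- The intermediate class `GG♮ b k`: as `GG b 1 k` but with an ARBITRARY polynomial numerator
in all `b + 1` base coordinates and a single `y`-pole `(y − ℓ(x'))^{−n}` that does not vanish on
the domain (the output of the engine before the numerator is made `y`-free). -/
def GNset (b k : ℕ) : Set KZ.FormalRep :=
  {w : KZ.FormalRep | ∃ (m m' n : ℕ) (s : KZ.IntegralRep (b + 1 + k)) (M : Fin m' → (Fin (b + 1) → ℚ) × ℚ) (L : Fin m → (Fin b → ℚ) × ℚ) (e : Fin m → ℕ) (p : MvPolynomial (Fin (b + 1)) ℚ) (ℓ : (Fin b → ℚ) × ℚ) (a : Fin k → Option ((Fin (b + 1) → ℚ) × ℚ)) (lo hi : Fin k → Fin k ⊕ ((Fin (b + 1) → ℚ) × ℚ)), (n ≠ 0 → ∀ z ∈ s.domain, z (Fin.castAdd k (Fin.last b)) - (∑ i, (ℓ.1 i : ℝ) * z (Fin.castAdd k (Fin.castSucc i)) + (ℓ.2 : ℝ)) ≠ 0) ∧ Bornology.IsBounded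 s.domain ∧ s.domain = {z | (∀ j, 0 < ∑ i, ((M j).1 i : ℝ) * z (Fin.castAdd k i) + ((M j).2 : ℝ)) ∧ ∀ i, Sum.elim (fun j => z (Fin.natAdd (b + 1) j)) (fun c => ∑ i', (c.1 i' : ℝ) * z (Fin.castAdd k i') + (c.2 : ℝ)) (lo i) < z (Fin.natAdd (b + 1) i) ∧ z (Fin.natAdd (b + 1) i) < Sum.elim (fun j => z (Fin.natAdd (b + 1) j)) (fun c => ∑ i', (c.1 i' : ℝ) * z (Fin.castAdd k i') + (c.2 : ℝ)) (hi i)} ∧ EqOn s.integrand (fun z => MvPolynomial.aeval (fun i => z (Fin.castAdd k i)) p / (∏ j, (∑ i, ((L j).1 i : ℝ) * z (Fin.castAdd k (Fin.castSucc i)) + ((L j).2 : ℝ)) ^ e j) * (1 / (z (Fin.castAdd k (Fin.last b)) - (∑ i, (ℓ.1 i : ℝ) * z (Fin.castAdd k (Fin.castSucc i)) + (ℓ.2 : ℝ))) ^ n) * ∏ i, (a i).elim 1 (fun c => 1 / (z (Fin.natAdd (b + 1) i) - (∑ i', (c.1 i' : ℝ) * z (Fin.castAdd k i') + (c.2 :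 ℝ))))) s.domain ∧ w = KZ.of s}

variable {b k m m' r : ℕ}

/-- Terminal case of the separation: if all active `y`-letters coincide and the numerator is
`y`-free, a representation of separation shape is literally an element of `GG b 1 k`
(`n₁ = 0`, `n₂ = ∑ dⱼ`). -/
theorem of_mem_GGset_of_shape (M : Fin m' → (Fin (b + 1) → ℚ) × ℚ) (L : Fin m → (Fin b → ℚ) × ℚ)
    (e : Fin m → ℕ) (p : MvPolynomial (Fin (b + 1)) ℚ) (p₀ : MvPolynomial (Fin b) ℚ)
    (hp : p = rename Fin.castSucc p₀) (lam : Fin r → (Fin b → ℚ) × ℚ) (d : Fin r → ℕ)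
    (a : Fin k → Option ((Fin (b + 1) → ℚ) × ℚ)) (lo hi : Fin k → Fin k ⊕ ((Fin (b + 1) → ℚ) × ℚ))
    (s : KZ.IntegralRep (b + 1 + k)) (hbd : Bornology.IsBounded s.domain)
    (hdom : s.domain = gDom b k m' M lo hi)
    (hint : EqOn s.integrand (shape b k p L e lam d a) s.domain) (ℓ : (Fin b → ℚ) × ℚ)
    (hℓ : ∀ j, d j ≠ 0 → lam j = ℓ) : KZ.of s ∈ GGset b 1 k := by
  refine ⟨m, m', 0, ∑ j, d j, s, M, L, e, p₀, ℓ, ℓ, a, lo, hi, Or.inl rfl,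
    fun h => absurd h (by decide), hbd, hdom, fun z hz => ?_, rfl⟩
  rw [hint hz]
  simp only [shape, fib, affB, pow_zero, one_div, hp, aeval_rename, Function.comp_def]
  congr 2
  rw [← Finset.prod_pow_eq_pow_sum, ← Finset.prod_inv_distrib]
  refine Finset.prod_congr rfl fun j _ => ?_
  by_cases hj : d j = 0
  · simp [hj]
  · rw [hℓ j hj]

/-- Lowering one multiplicity in the letter block multiplies it by the letter. -/
theorem prod_inv_pow_update (u : Fin r → ℝ) (d : Fin r → ℕ) (j : Fin r) (hd : d j ≠ 0)
    (hu : u j ≠ 0) :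
    ∏ i, (u i ^ Function.update d j (d j - 1) i)⁻¹ = (∏ i, (u i ^ d i)⁻¹) * u j := by
  obtain ⟨n, hn⟩ := Nat.exists_eq_succ_of_ne_zero hd
  have h1 : (fun i => (u i ^ Function.update d j (d j - 1) i)⁻¹) =
      Function.update (fun i => (u i ^ d i)⁻¹) j ((u j ^ (d j - 1))⁻¹) := by
    funext i
    by_cases hij : i = j
    · subst hij; simp
    · simp [Function.update_of_ne hij]
  rw [h1, Finset.prod_update_of_mem (Finset.mem_univ j),
    Finset.prod_eq_mul_prod_sdiff_singleton_of_mem (Finset.mem_univ j) (fun i => (u i ^ d i)⁻¹),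
    hn, Nat.succ_sub_one, pow_succ, mul_inv]
  field_simp

/-- The algebra of one separation step:
`shape · (y − λ_{j'})/(λ_j − λ_{j'})` is again of separation shape, with the resultant form
`λ_j − λ_{j'}` appended to the `x'`-denominators and the multiplicity of `λ_{j'}` lowered. -/
theorem shape_mul_eq (p : MvPolynomial (Fin (b + 1)) ℚ) (L : Fin m → (Fin b → ℚ) × ℚ)
    (e : Fin m → ℕ) (lam : Fin r → (Fin b → ℚ) × ℚ) (d : Fin r → ℕ)
    (a : Fin k → Option ((Fin (b + 1) → ℚ) × ℚ))
    (j j' : Fin r) (z : Fin (b + 1 + k) → ℝ) (hd : d j' ≠ 0)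
    (hu : z (Fin.castAdd k (Fin.last b)) - affB b k (lam j') z ≠ 0) :
    shape b k p L e lam d a z * ((z (Fin.castAdd k (Fin.last b)) - affB b k (lam j') z) /
      (affB b k (lam j) z - affB b k (lam j') z)) =
    shape b k p (Fin.snoc L (lam j - lam j') : Fin (m + 1) → (Fin b → ℚ) × ℚ)
      (Fin.snoc e 1 : Fin (m + 1) → ℕ) lam (Function.update d j' (d j' - 1)) a z := by
  simp only [shape, Fin.prod_univ_castSucc, Fin.snoc_castSucc, Fin.snoc_last, pow_one, affB_sub]
  rw [prod_inv_pow_update (fun i => z (Fin.castAdd k (Fin.last b)) - affB b k (lam i) z) d j' hd hu,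
    div_mul_eq_div_mul_one_div,
    div_eq_mul_one_div (z _ - affB b k (lam j') z) (affB b k (lam j) z - _)]
  ring

/-- One separation piece: multiply by the semialgebraic factor `(y − λ_{j'})/(λ_j − λ_{j'})`,
assumed BOUNDED on the domain (rule 1b with domination). -/
theorem exists_piece (L : Fin m → (Fin b → ℚ) × ℚ) (e : Fin m → ℕ)
    (p : MvPolynomial (Fin (b + 1)) ℚ)
    (lam : Fin r → (Fin b → ℚ) × ℚ) (d : Fin r → ℕ) (a : Fin k → Option ((Fin (b + 1) → ℚ) × ℚ))
    (s : KZ.IntegralRep (b + 1 + k))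
    (hint : EqOn s.integrand (shape b k p L e lam d a) s.domain) (j j' : Fin r) (hd : d j' ≠ 0)
    (hpole : ∀ z ∈ s.domain, z (Fin.castAdd k (Fin.last b)) - affB b k (lam j') z ≠ 0) {C : ℝ}
    (hC : ∀ z ∈ s.domain, |z (Fin.castAdd k (Fin.last b)) - affB b k (lam j') z| ≤
      C * |affB b k (lam j) z - affB b k (lam j') z|) :
    ∃ s' : KZ.IntegralRep (b + 1 + k), s'.domain = s.domain ∧
      (∀ z, s'.integrand z = s.integrand z * ((z (Fin.castAdd k (Fin.last b)) -
        affB b k (lam j') z) / (affB b k (lam j) z - affB b k (lam j') z))) ∧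
      EqOn s'.integrand (shape b k p (Fin.snoc L (lam j - lam j') : Fin (m + 1) → (Fin b → ℚ) × ℚ)
        (Fin.snoc e 1 : Fin (m + 1) → ℕ) lam (Function.update d j' (d j' - 1)) a) s'.domain := by
  have hR : ∀ z ∈ s.domain, affB b k (lam j) z - affB b k (lam j') z ≠ 0 := fun z hz h =>
    hpole z hz (abs_eq_zero.mp (le_antisymm (by simpa [h] using hC z hz) (abs_nonneg _)))
  set g : (Fin (b + 1 + k) → ℝ) → ℝ := fun z => (z (Fin.castAdd k (Fin.last b)) -
    affB b k (lam j') z) / (affB b k (lam j) z - affB b k (lam j') z) with hg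
  have hsa : IsSemialgebraicFunOn ℚ s.domain g := by
    refine (isSemialgebraicFunOn_aeval_div_aeval s.isSemialgebraic_domain
      (X (Fin.castAdd k (Fin.last b)) - affPoly b k (lam j'))
      (affPoly b k (lam j) - affPoly b k (lam j')) fun z hz => ?_).congr fun z hz => ?_
    · rw [map_sub, aeval_affPoly, aeval_affPoly]
      exact hR z hz
    · simp only [map_sub, aeval_X, aeval_affPoly, hg]
  have hbdd : ∀ z ∈ s.domain, |g z| ≤ max C 0 := by
    intro z hz
    rw [hg, abs_div, div_le_iff₀ (abs_pos.mpr (hR z hz))]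
    exact (hC z hz).trans (mul_le_mul_of_nonneg_right (le_max_left _ _) (abs_nonneg _))
  refine ⟨mulRep s g hsa _ hbdd, rfl, fun z => rfl, fun z hz => ?_⟩
  show s.integrand z * g z = _
  rw [hint hz, hg]
  exact shape_mul_eq p L e lam d a j j' z hd (hpole z hz)

end Classes

section Induction

variable {b k m m' r : ℕ}

/-- An index with non-zero lowered multiplicity had non-zero multiplicity. -/
theorem ne_zero_of_update_ne_zero {d : Fin r → ℕ} {j i : Fin r}
    (h : Function.update d j (d j - 1) i ≠ 0) : d i ≠ 0 := by
  by_cases hij : i = j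
  · subst hij
    simp only [Function.update_self] at h
    omega
  · rwa [Function.update_of_ne hij] at h

/-- **Separation by induction on the total letter multiplicity** (dominated case). A bounded
representation of separation shape whose active `y`-letters `y − λ_j` do not vanish on the domain
and satisfy the RATIO (domination) condition `|y − λ_{j'}| ≤ C |λ_j − λ_{j'}|` on the domain for
all pairs of distinct active letters is congruent modulo `KZ.relations` to a `ℤ`-combination of
elements of any class `T` containing the single-letter shapes: repeatedly split
`1/((y−λ)(y−μ)) = (λ−μ)⁻¹ (1/(y−λ) − 1/(y−μ))` by rule (1b), each piece being the parent times
the bounded factor `(y − μ)/(λ − μ)`; the numerator `P(x', y)` is carried unchanged. -/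
theorem sep_induction (b k m' r : ℕ) (M : Fin m' → (Fin (b + 1) → ℚ) × ℚ)
    (p : MvPolynomial (Fin (b + 1)) ℚ) (lam : Fin r → (Fin b → ℚ) × ℚ)
    (a : Fin k → Option ((Fin (b + 1) → ℚ) × ℚ)) (lo hi : Fin k → Fin k ⊕ ((Fin (b + 1) → ℚ) × ℚ))
    (T : Set KZ.FormalRep)
    (hT : ∀ (m : ℕ) (L : Fin m → (Fin b → ℚ) × ℚ) (e : Fin m → ℕ) (d : Fin r → ℕ)
      (s : KZ.IntegralRep (b + 1 + k)) (ℓ : (Fin b → ℚ) × ℚ), Bornology.IsBounded s.domain →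
      s.domain = gDom b k m' M lo hi → EqOn s.integrand (shape b k p L e lam d a) s.domain →
      (∀ j, d j ≠ 0 → ∀ z ∈ s.domain, z (Fin.castAdd k (Fin.last b)) - affB b k (lam j) z ≠ 0) →
      (∀ j, d j ≠ 0 → lam j = ℓ) → KZ.of s ∈ T)
    (N : ℕ) :
    ∀ (m : ℕ) (L : Fin m → (Fin b → ℚ) × ℚ) (e : Fin m → ℕ) (d : Fin r → ℕ)
      (s : KZ.IntegralRep (b + 1 + k)), ∑ j, d j = N → Bornology.IsBounded s.domain →
      s.domain = gDom b k m' M lo hi → EqOn s.integrand (shape b k p L e lam d a) s.domain →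
      (∀ j, d j ≠ 0 → ∀ z ∈ s.domain, z (Fin.castAdd k (Fin.last b)) - affB b k (lam j) z ≠ 0) →
      (∀ j j', d j ≠ 0 → d j' ≠ 0 → lam j ≠ lam j' → ∃ C, ∀ z ∈ s.domain,
        |z (Fin.castAdd k (Fin.last b)) - affB b k (lam j') z| ≤
          C * |affB b k (lam j) z - affB b k (lam j') z|) →
      ∃ c ∈ AddSubgroup.closure T, KZ.of s - c ∈ KZ.relations := by
  induction N with
  | zero =>
    intro m L e d s hN hbd hdom hint hpole _
    have hd : ∀ j, d j = 0 := fun j => (Finset.sum_eq_zero_iff.mp hN) j (Finset.mem_univ j)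
    exact ⟨KZ.of s, AddSubgroup.subset_closure (hT m L e d s 0 hbd hdom hint hpole
      fun j hj => absurd (hd j) hj), by simp⟩
  | succ N ih =>
    intro m L e d s hN hbd hdom hint hpole hwall
    by_cases hsplit : ∃ j j', d j ≠ 0 ∧ d j' ≠ 0 ∧ lam j ≠ lam j'
    · obtain ⟨j, j', hj, hj', hne⟩ := hsplit
      obtain ⟨C₁, hC₁⟩ := hwall j j' hj hj' hne
      obtain ⟨C₂, hC₂⟩ := hwall j' j hj' hj hne.symm
      obtain ⟨s₁, hd₁, hg₁, hi₁⟩ := exists_piece L e p lam d a s hint j j' hj' (hpole j' hj') hC₁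
      obtain ⟨s₂, hd₂, hg₂, hi₂⟩ := exists_piece L e p lam d a s hint j' j hj (hpole j hj) hC₂
      have hrel : KZ.of s - KZ.of s₁ - KZ.of s₂ ∈ KZ.relations := by
        refine KZ.integrandAddRel_subset_relations ⟨_, s, s₁, s₂, hd₁, hd₂, fun z hz => ?_, rfl⟩
        have hR : affB b k (lam j) z - affB b k (lam j') z ≠ 0 := fun h => hpole j' hj' z hz
          (abs_eq_zero.mp (le_antisymm (by simpa [h] using hC₁ z hz) (abs_nonneg _)))
        have key : (z (Fin.castAdd k (Fin.last b)) - affB b k (lam j') z) /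
              (affB b k (lam j) z - affB b k (lam j') z) +
            (z (Fin.castAdd k (Fin.last b)) - affB b k (lam j) z) /
              (affB b k (lam j') z - affB b k (lam j) z) = 1 := by
          rw [show affB b k (lam j') z - affB b k (lam j) z =
              -(affB b k (lam j) z - affB b k (lam j') z) by ring, div_neg, ← sub_eq_add_neg,
            ← sub_div, div_eq_one_iff_eq hR]
          ring
        rw [Pi.add_apply, hg₁, hg₂, ← mul_add, key, mul_one]
      have hsum : ∀ i : Fin r, d i ≠ 0 → ∑ l, Function.update d i (d i - 1) l = N := by
        intro i hi
        rw [Finset.sum_update_of_mem (Finset.mem_univ _)]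
        have h1 := Finset.sum_eq_add_sum_sdiff_singleton_of_mem (Finset.mem_univ i) d
        omega
      obtain ⟨c₁, hc₁, hr₁⟩ := ih (m + 1) _ _ _ s₁ (hsum j' hj') (by rw [hd₁]; exact hbd)
        (hd₁.trans hdom) hi₁
        (fun i hi z hz => hpole i (ne_zero_of_update_ne_zero hi) z (by rw [← hd₁]; exact hz))
        (fun i i' hi hi' hii' => by
          obtain ⟨C', hb'⟩ := hwall i i' (ne_zero_of_update_ne_zero hi)
            (ne_zero_of_update_ne_zero hi') hii'
          exact ⟨C', fun z hz => hb' z (by rw [← hd₁]; exact hz)⟩)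
      obtain ⟨c₂, hc₂, hr₂⟩ := ih (m + 1) _ _ _ s₂ (hsum j hj) (by rw [hd₂]; exact hbd)
        (hd₂.trans hdom) hi₂
        (fun i hi z hz => hpole i (ne_zero_of_update_ne_zero hi) z (by rw [← hd₂]; exact hz))
        (fun i i' hi hi' hii' => by
          obtain ⟨C', hb'⟩ := hwall i i' (ne_zero_of_update_ne_zero hi)
            (ne_zero_of_update_ne_zero hi') hii'
          exact ⟨C', fun z hz => hb' z (by rw [← hd₂]; exact hz)⟩)
      refine ⟨c₁ + c₂, add_mem hc₁ hc₂, ?_⟩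
      have : KZ.of s - (c₁ + c₂) =
          (KZ.of s - KZ.of s₁ - KZ.of s₂) + (KZ.of s₁ - c₁) + (KZ.of s₂ - c₂) := by abel
      rw [this]
      exact add_mem (add_mem hrel hr₁) hr₂
    · push Not at hsplit
      have hℓ : ∃ ℓ, ∀ j, d j ≠ 0 → lam j = ℓ := by
        by_cases h : ∃ j, d j ≠ 0
        · obtain ⟨j₀, hj₀⟩ := h
          exact ⟨lam j₀, fun j hj => hsplit j j₀ hj hj₀⟩
        · push Not at h
          exact ⟨0, fun j hj => absurd (h j) hj⟩
      obtain ⟨ℓ, hℓ⟩ := hℓ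
      exact ⟨KZ.of s, AddSubgroup.subset_closure (hT m L e d s ℓ hbd hdom hint hpole hℓ),
        by simp⟩

end Induction

end SeparatePos

/-- **Registered sub-goal** (the multiplicity-lowering identity of the separation engine):
lowering the multiplicity `d j ≠ 0` of one non-vanishing letter `u j` by one multiplies the
inverse letter block `∏ᵢ (uᵢ ^ dᵢ)⁻¹` by `u j`. -/
theorem separatePos_prod_inv_pow_update (r : ℕ) (u : Fin r → ℝ) (d : Fin r → ℕ) (j : Fin r) (hd : d j ≠ 0) (hu : u j ≠ 0) : ∏ i, (u i ^ Function.update d j (d j - 1) i)⁻¹ = (∏ i, (u i ^ d i)⁻¹) * u j :=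
  SeparatePos.prod_inv_pow_update u d j hd hu

end Summit.KontsevichZagierPeriods.ArrangementNormalForm.JanusBands
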